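import Summits.BirchSwinnertonDyer.Rank1Residual.Additive.CongruentPartnerMainConjectureX3Gord
import Summits.BirchSwinnertonDyer.Rank1Residual.Additive.CongruentPartnerMainConjectureGordBSD
import Summits.BirchSwinnertonDyer.Rank1Residual.Additive.GordCharLeadingTermConsequences
import Summits.BirchSwinnertonDyer.Rank1Residual.Additive.GordThreeCycLowerCore
import Summits.BirchSwinnertonDyer.Rank1Residual.AdditivePotMult.CyclotomicThreeOfHalf
import HarnessLib

/-!
# "ROUTE G" on X3♯(G-ord) ∩ `I₀*` (REDUCIBLE `E[p]`), rank `0`: `BSD(E,p)` / the LOWER half from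
# Wuthrich's divisibility + ONE unit coefficient at index `b` + the budget bound `BudgetLeLambdaAt p W b`,
# off the anomalous rows — the X3♯(G-ord) twin of n1011-p10's `CongruentPartnerMainConjectureGordBSD.lean`
# (team n1011, seat n1011-p06 gen 3, OWNERS row T-E3gX3 = lead GEN 6 R5-31 deal (β); FILE 2 of 3)

HONEST FRAMING (cell `b2b-bsdres`, run/shared/lean/b2b/bsd-rank1-residual/, verbatim in every
file): the goal of the cell is to DELETE the COMBINATION-SHAPED residual classes of the
Birch–Swinnerton-Dyer formula for ALL analytic-rank `≤ 1` elliptic curves over `ℚ` — "full BSD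
formula for every rank `≤ 1` curve in class `C`" assembled STRICTLY from published theorems — so
that the rank-`≤ 1` remainder becomes exactly the CONSTRUCTION-SHAPED classes, which are TYPED
(missing-input `Prop`s), NOT attempted. This is not "finishing BSD". Team n1011 (RESIDUAL-MAP §I
N10, the X3♯(G-ord) share: `E[p]` REDUCIBLE, additive potentially good ordinary of type (G) at `p`,
defect `e = 2`, `r_an = 0`): research route on a CONSTRUCTION-SHAPED class; prove what is provable now;
no claim beyond stated classes; census output = EVIDENCE / conjecture items, never a Literature fact;
X3♯(G-ord) stays CONSTRUCTION-SHAPED; RESIDUAL-MAP marks UNCHANGED; nothing is booked by this file.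
THEOREMS ONLY (no definition, no named fact); named facts enter as HYPOTHESES (`hWu` Wuthrich 2014
Thm. 16 half-eigenspace form; `hPal` Pal 2012 Thm. 3.2 — used only at `p ≡ 1 (mod 4)` inside p07's
class-free branch ↔ cyclotomic bridge; Delbourgo 2002 (A)+(B) `hDel` / AT 3 `hDel3`; Delbourgo 1998
Prop. 4 `hDel98`; GZK; modularity); p10's typed inputs `BranchUnitCoeffAt W p b` (ENGINE value per
pair, two-engine rule) and `BudgetLeLambdaAt p W b` (per-curve lower bound; on X3 NO printed EPW
discharge — flag `X3-budget-no-EPW` ≡ r2's `X3-budget-unprinted`, ROUTE-2 §II.13–14, FILE 1) are HYPOTHESES, NOT re-declared.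

## What (every consumer BY NAME; nothing restated)

* §1 `ClassX3Gord.cycLowerLeadingTermAt_of_wuthrichHalf_of_coeffCert_of_budget` — every odd `p`: the
  `T = 0` LOWER input `CycLowerLeadingTermAt W p` (additive-p2 gen 18) HOLDS on a certified eligible
  X3♯(G-ord) ∩ `I₀*` row, via FILE 1's K-OUT + p07's class-free Λ-adic ⟹ `T = 0` bridges
  (`chiBranchLowerLeadingTerm[Odd]At_of_divisibility[Odd]_of_padicValRat_j_nonneg`,
  `cycLowerLeadingTermAt_iff_chiBranchLower[Odd]_of_typeGOrd_of_semistabilityIndex_eq_two`).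
* §2 `ClassX3Gord.missingLowerBoundAt_rankZero_of_wuthrichHalf_of_coeffCert_of_budget_of_nonAnomalous`
  (`p ≥ 5`) and `ClassX3Gord.bsdp_rankZero_of_wuthrichHalf_of_coeffCert_of_budget_of_nonAnomalous`
  (`p ≥ 5`): the rank-`0` LOWER half resp. `BSD(E,p)` off the anomalous rows (additive-p2's
  `ClassX3Gord.missingLowerBoundAt_rankZero_of_cycLower_of_nonAnomalous` /
  `ClassX3Gord.bsdp_rankZero_of_cycLower_of_wuthrichComponent` — Wuthrich serves BOTH halves).
* §1 (odd arm) `…_of_mod_four_eq_three`: the same at `p ≡ 3 (mod 4)` WITHOUT the idle Pal binder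
  (Birch's `Ω⁻`-relation only — referee 1 GEN 8's note on p10's file, pre-empted here).
* §3 `ClassX3Gord.bsdp_three_rankZero_of_wuthrichHalf_of_coeffCert_of_budget_of_nonAnomalous`
  (`p = 3`, NO Pal binder: p16's `Delbourgo2002.mainTheorem_three`, additive-p1's reducible-twist UPPER
  chain at 3 via `AdditivePotMult.thm16_minusEigenCharIdeal_dvd_cyclotomicThree_of_half hWu`; NO tower
  needed on X3).
NO image hypothesis anywhere. Binder honesty as in FILE 1: `hcm`, `hna` row binders; the unit
coefficient and the budget are per-pair EVIDENCE / typed inputs; nothing booked; no class theorem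
closes a row by itself; e ∈ {3,4,6}, wild 3, `p = 2` untouched.

References: C. Wuthrich, Doc. Math. 19 (2014) Thm. 16 (p. 397) [Wuthrich2014]; D. Delbourgo,
J. Number Theory 95 (2002) Thm. (A), (B) (p. 40) [Delbourgo2002]; D. Delbourgo, Compositio Math. 113
(1998) Prop. 4 (p. 144) [Delbourgo1998]; A. Pal, Proc. AMS 140 (2012) Thm. 3.2 [Pal2012];
B. Mazur, J. Tate, J. Teitelbaum, Invent. Math. 84 (1986) §I.14 [MazurTateTeitelbaum1986Invent];
R. L. Miller, LMS J. Comput. Math. 14 (2011) Def. 1.1 [Miller2011LMS].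
-/

set_option autoImplicit false

noncomputable section

open scoped Classical MatrixGroups ModularForm NumberField

open CongruenceSubgroup WeierstrassCurve NumberField Literature.NumberTheory.EllipticCurves
  Literature.NumberTheory.EllipticCurves.ModularForms
  Literature.NumberTheory.EllipticCurves.Rank1Residual
  Literature.NumberTheory.EllipticCurves.Rank1Residual.Typed
  Literature.NumberTheory.GaloisRepresentations
  Literature.NumberTheory.EllipticCurves.Wuthrich2014
  Literature.NumberTheory.EllipticCurves.GreenbergVatsal2000
  Literature.NumberTheory.EllipticCurves.Delbourgo2002
  Summit.BirchSwinnertonDyer.Rank1Residual.AdditivePotMult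
  Summit.BirchSwinnertonDyer.Rank1Residual.X1.MuLambda
  Summit.BirchSwinnertonDyer.Rank1Residual.Iwasawa
  IsDedekindDomain

namespace Summit.BirchSwinnertonDyer.Rank1Residual.Additive

variable {W : WeierstrassCurve ℚ} [W.IsElliptic] [W.IsGloballyMinimal] {p : ℕ} [hp : Fact p.Prime]

/-! ### §1 The `T = 0` LOWER input `CycLowerLeadingTermAt` from the budget main conjecture (reducible rows) -/

/-- **`X_D1` at `T = 0` HOLDS on a certified eligible X3♯(G-ord) ∩ `I₀*` row** (every odd `p`; NO image
hypothesis): Wuthrich half + `BranchUnitCoeffAt W p b` + `BudgetLeLambdaAt p W b` ⟹ `CycLowerLeadingTermAt W p`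
(every generator `f` of `char_Λ X(E/ℚ_∞)` has `q ∣ f(0)`, `q = L(E,1)/Ω_E`), via FILE 1's Λ-adic LOWER
outputs and p07's class-free Λ-adic ⟹ `T = 0` and branch ↔ cyclotomic bridges (Birch; Pal at `p ≡ 1 (4)`).
[cite: Wuthrich2014, Thm. 16 (p. 397)] [cite: Pal2012, Thm. 3.2] [cite: MazurTateTeitelbaum1986Invent, §I.14] -/
theorem ClassX3Gord.cycLowerLeadingTermAt_of_wuthrichHalf_of_coeffCert_of_budget
    (hWu : Wuthrich2014.thm16_halfEigenCharIdeal_dvd_cyclotomicPrime)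
    (hPal : Pal2012.thm32_sqrt_mul_realPeriodRat_twist_eq_of_prime_one_mod_four)
    (hmod : hasEntireLFunction_rat) (hmodD : nonempty_modularParametrizationData)
    (hp2 : p ≠ 2) (hX : ClassX3Gord W p) (he : semistabilityIndex W p = 2)
    {b : ℕ} (hcert : BranchUnitCoeffAt W p b) (hbud : BudgetLeLambdaAt p W b) :
    CycLowerLeadingTermAt W p := by
  have hj := padicValRat_j_nonneg_of_typeGOrd W p hX.typeGOrd
  have hodd : p % 4 = 1 ∨ p % 4 = 3 := by
    obtain ⟨k, hk⟩ := hp.out.odd_of_ne_two hp2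
    omega
  rcases hodd with h1 | h3
  · exact (cycLowerLeadingTermAt_iff_chiBranchLower_of_typeGOrd_of_semistabilityIndex_eq_two W p hPal
      hmod hmodD h1 hX.addv hX.typeGOrd he).mpr
      (chiBranchLowerLeadingTermAt_of_divisibility_of_padicValRat_j_nonneg p W hj
        (hX.chiBranchLowerDivisibilityAt_of_wuthrichHalf_of_coeffCert_of_budget hWu hcert hbud))
  · exact (cycLowerLeadingTermAt_iff_chiBranchLowerOdd_of_typeGOrd_of_semistabilityIndex_eq_two W p
      hmod hmodD h3 hX.addv hX.typeGOrd he).mpr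
      (chiBranchLowerLeadingTermOddAt_of_divisibilityOdd_of_padicValRat_j_nonneg p W hj
        (hX.chiBranchLowerDivisibilityOddAt_of_wuthrichHalf_of_coeffCert_of_budget hWu hcert hbud))

/-- **`X_D1` at `T = 0` on a certified eligible X3♯(G-ord) row, `p ≡ 3 (mod 4)` (`p = 3` included), NO
Pal binder**: Wuthrich half + `BranchUnitCoeffAt W p b` + `BudgetLeLambdaAt p W b` ⟹ `CycLowerLeadingTermAt W p`
via FILE 1's ODD Λ-adic LOWER output and p07's odd bridge
`cycLowerLeadingTermAt_iff_chiBranchLowerOdd_of_typeGOrd_of_semistabilityIndex_eq_two` (Birch's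
`Ω⁻`-relation only; Pal 2012 Thm. 3.2 is a `p ≡ 1 (mod 4)` statement and is never invoked — the
`p % 4 = 3` arm of the theorem above with its honest binder list, as p10's `…_of_mod_four_eq_three`).
[cite: Wuthrich2014, Thm. 16 (p. 397)] [cite: MazurTateTeitelbaum1986Invent, §I.14] -/
theorem ClassX3Gord.cycLowerLeadingTermAt_of_wuthrichHalf_of_coeffCert_of_budget_of_mod_four_eq_three
    (hWu : Wuthrich2014.thm16_halfEigenCharIdeal_dvd_cyclotomicPrime)
    (hmod : hasEntireLFunction_rat) (hmodD : nonempty_modularParametrizationData)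
    (hX : ClassX3Gord W p) (he : semistabilityIndex W p = 2) (h3 : p % 4 = 3)
    {b : ℕ} (hcert : BranchUnitCoeffAt W p b) (hbud : BudgetLeLambdaAt p W b) :
    CycLowerLeadingTermAt W p :=
  (cycLowerLeadingTermAt_iff_chiBranchLowerOdd_of_typeGOrd_of_semistabilityIndex_eq_two W p hmod hmodD
      h3 hX.addv hX.typeGOrd he).mpr
    (chiBranchLowerLeadingTermOddAt_of_divisibilityOdd_of_padicValRat_j_nonneg p W
      (padicValRat_j_nonneg_of_typeGOrd W p hX.typeGOrd)
      (hX.chiBranchLowerDivisibilityOddAt_of_wuthrichHalf_of_coeffCert_of_budget hWu hcert hbud))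

/-! ### §2 The LOWER half and `BSD(E,p)` in rank `0` off the anomalous rows, `p ≥ 5` -/

/-- **X3♯(G-ord) ∩ `I₀*`, `p ≥ 5`, `r_an = 0`, non-CM, non-anomalous: the LOWER half
`ord_p #Ш_an ≤ ord_p #Ш` from Wuthrich half + ONE unit coefficient at index `b` + the budget bound.**
NO image hypothesis. [cite: Wuthrich2014, Thm. 16 (p. 397)] [cite: Delbourgo2002, Theorem (A), (B) (p. 40)]
[cite: Miller2011LMS, Def. 1.1] -/
theorem ClassX3Gord.missingLowerBoundAt_rankZero_of_wuthrichHalf_of_coeffCert_of_budget_of_nonAnomalous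
    (hWu : Wuthrich2014.thm16_halfEigenCharIdeal_dvd_cyclotomicPrime)
    (hPal : Pal2012.thm32_sqrt_mul_realPeriodRat_twist_eq_of_prime_one_mod_four)
    (hDel : Delbourgo2002.mainTheorem) (hGZK : rank_eq_analyticRank_of_analyticRank_le_one)
    (hmod : hasEntireLFunction_rat) (hmodD : nonempty_modularParametrizationData)
    (hX : ClassX3Gord W p) (hcm : ¬ W.HasCM) (hp5 : 5 ≤ p) (he : semistabilityIndex W p = 2)
    (hr : W.analyticRank = 0)
    {b : ℕ} (hcert : BranchUnitCoeffAt W p b) (hbud : BudgetLeLambdaAt p W b)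
    (hna : ReductionNonAnomalous W p) : MissingLowerBoundAt W p :=
  ClassX3Gord.missingLowerBoundAt_rankZero_of_cycLower_of_nonAnomalous hDel hGZK hmod hX hcm hp5 hr
    (hX.cycLowerLeadingTermAt_of_wuthrichHalf_of_coeffCert_of_budget hWu hPal hmod hmodD (by omega) he
      hcert hbud) hna

/-- **X3♯(G-ord) ∩ `I₀*`, `p ≥ 5`, `r_an = 0`, non-CM, non-anomalous: `BSD(E,p)` from the named facts +
ONE unit coefficient at index `b` + the budget bound `BudgetLeLambdaAt p W b`** — partner-free Route G on
the reducible rows: upper half = the Wuthrich component chain (`ClassX3Gord.cycLeadingTermAt_of_wuthrichComponent`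
+ Delbourgo 1998 Prop. 4, inside `ClassX3Gord.bsdp_rankZero_of_cycLower_of_wuthrichComponent`), lower
half = §1; Wuthrich Thm. 16 serves BOTH halves; NO image hypothesis, NO Kolyvagin.
[cite: Wuthrich2014, Thm. 16 (p. 397)] [cite: Delbourgo2002, Theorem (A), (B) (p. 40)]
[cite: Delbourgo1998, Prop. 4 (p. 144)] [cite: Pal2012, Thm. 3.2] [cite: Miller2011LMS, §1 and Def. 1.1] -/
theorem ClassX3Gord.bsdp_rankZero_of_wuthrichHalf_of_coeffCert_of_budget_of_nonAnomalous
    (hWu : Wuthrich2014.thm16_halfEigenCharIdeal_dvd_cyclotomicPrime)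
    (hPal : Pal2012.thm32_sqrt_mul_realPeriodRat_twist_eq_of_prime_one_mod_four)
    (hDel98 : Delbourgo1998.prop4_rankZero_pow_dvd_constantCoeff) (hDel : Delbourgo2002.mainTheorem)
    (hGZK : rank_eq_analyticRank_of_analyticRank_le_one) (hmod : hasEntireLFunction_rat)
    (hmodD : nonempty_modularParametrizationData)
    (hX : ClassX3Gord W p) (hcm : ¬ W.HasCM) (hp5 : 5 ≤ p) (he : semistabilityIndex W p = 2)
    (hr : W.analyticRank = 0)
    {b : ℕ} (hcert : BranchUnitCoeffAt W p b) (hbud : BudgetLeLambdaAt p W b)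
    (hna : ReductionNonAnomalous W p) : BSDp W p :=
  ClassX3Gord.bsdp_rankZero_of_cycLower_of_wuthrichComponent
    (Wuthrich2014.charIdeal_dvd_padicLFunctionBranch_component_of_half hWu) hPal hDel98 hDel hGZK hmod
    hmodD hX hcm hp5 he hr
    (hX.cycLowerLeadingTermAt_of_wuthrichHalf_of_coeffCert_of_budget hWu hPal hmod hmodD (by omega) he
      hcert hbud) hna

/-! ### §3 `BSD(E,3)` in rank `0` off the anomalous rows (`p = 3`: `mainTheorem_three`; NO tower, NO Pal on X3) -/

/-- **X3♯(G-ord) at `3` (`I₀*` automatic), `r_an = 0`, non-CM, non-anomalous: `BSD(E,3)` from the named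
facts (Wuthrich Thm. 16 `hWu` — BOTH halves, the upper one through additive-p1's reducible-twist chain
at `3` via `AdditivePotMult.thm16_minusEigenCharIdeal_dvd_cyclotomicThree_of_half`; Delbourgo 1998
Prop. 4; Delbourgo 2002 AT 3 = `mainTheorem_three`; GZK; modularity) + ONE 3-adic unit coefficient at
index `b` on the `ω`-branch of `E^{(−3)}` + the budget bound.** NO image hypothesis, NO tower, NO Pal binder
(§1's `…_of_mod_four_eq_three` arm, `3 % 4 = 3`). [cite: Wuthrich2014, Thm. 16 (p. 397)]
[cite: Delbourgo2002, Theorem (A), (B) (p. 40), Hypothesis (p. 39)] [cite: Delbourgo1998, Prop. 4 (p. 144)]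
[cite: Miller2011LMS, §1 and Def. 1.1] -/
theorem ClassX3Gord.bsdp_three_rankZero_of_wuthrichHalf_of_coeffCert_of_budget_of_nonAnomalous
    [Fact (Nat.Prime 3)] {W : WeierstrassCurve ℚ} [W.IsElliptic] [W.IsGloballyMinimal]
    (hWu : Wuthrich2014.thm16_halfEigenCharIdeal_dvd_cyclotomicPrime)
    (hDel98 : Delbourgo1998.prop4_rankZero_pow_dvd_constantCoeff)
    (hDel3 : Delbourgo2002.mainTheorem_three)
    (hGZK : rank_eq_analyticRank_of_analyticRank_le_one) (hmod : hasEntireLFunction_rat)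
    (hmodD : nonempty_modularParametrizationData)
    (hX : ClassX3Gord W 3) (hcm : ¬ W.HasCM) (hr : W.analyticRank = 0)
    {b : ℕ} (hcert : BranchUnitCoeffAt W 3 b) (hbud : BudgetLeLambdaAt 3 W b)
    (hna : ReductionNonAnomalous W 3) : BSDp W 3 :=
  have he : semistabilityIndex W 3 = 2 := semistabilityIndex_eq_two_of_typeG_three W hX.typeGOrd.typeG hX.addv
  ClassX3Gord.bsdp_three_rankZero_of_cycLower_of_nonAnomalous hDel3
    (thm16_minusEigenCharIdeal_dvd_cyclotomicThree_of_half hWu) hDel98 hGZK hmod hmodD hX hcm hr hna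
    (hX.cycLowerLeadingTermAt_of_wuthrichHalf_of_coeffCert_of_budget_of_mod_four_eq_three hWu hmod hmodD he
      rfl hcert hbud)

end Summit.BirchSwinnertonDyer.Rank1Residual.Additive

end
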